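import Literature.AnabelianGeometry.SemiGraphs.TemperedHbddOfLocallyFinite
import Literature.AnabelianGeometry.SemiGraphs.TemperedCentralizerEscapeDichotomy
import HarnessLib

/-!
# [SemiAnbd] Thm 3.7 (iii) / Cor 3.9 (R3c) at ANY valence: an escape CONFINED over one base edge is
# impossible (`hbdd` with bound `4` for confined pairs; no escaping centraliser confined over one edge)

Mochizuki, *Semi-graphs of anabelioids*, Publ. RIMS **42** (2006), §3, Theorem 3.7 (iii), manuscript
p. 41 ("if `H` fixes two vertices of `𝒢_{∞,j}`, then these two vertices are joined to one another by a
single edge"), with the author's *Comments* (2020) (6)(b), and Corollary 3.9, proof p. 43 l. 13 ("[again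
by Theorem 3.7, (iii), (iv)]"; the cell's step (R3c), FACT-LIST rows F-2772 `EdgeLikeCentralizerAt` /
F-2773 `EdgeLikeCentralizer`) [cite: MochizukiSemiAnbd2006, Thm 3.7(iii) p.41].

PROOF-ONLY (cell abc-iut, block F, seat abc-iut-f-172 gen 5; residual «infinite valence» of GAP row
G-t6g3-2b; memo HOME/staging/f/f-172/gen5/RETRACTION-STAR-F2773-memo.md §2 (S3), case (I) «CONFINED»;
no definition, no named fact).  abc-iut-w6-d062's `dist_le_four_of_localLevelEstranged`
(`TemperedHbddOfLocalLevelEstrangement.lean`) folds the `C`-fixed geodesic of a deep level along the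
transition map under the LOCAL level-estrangement binder (LE_C,w) — all `C`-fixed branch pairs at tree
vertices over `w` — which at a vertex of INFINITE valence is not available uniformly (infinitely many
pairs of base branches; only the per-pair depth lemmas `eventually_not_fixed_pair_of_ne_base_pair` /
`eventually_fold_same_base_pair` hold there).  The folding (`SemiGraph.vertexMap_eq_or_eq_of_folding`)
is, however, over an ARBITRARY set `F` of nodes containing the walk: shrinking `F` to the `C`-fixed nodes
WHOSE BRANCHES LIE OVER ONE BASE EDGE `e₀` makes the binder bite only on pairs of tree branches over
`e₀` — at most two base branches, so the per-pair lemmas suffice at ANY valence.  Results: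

* `VerticialLevelData.dist_le_four_of_confined` — over abstract level data: under (LE_C,w)|_{e₀} (two
  `C`-fixed edges at a tree vertex over `w` whose branches there both lie over `e₀` have the same image
  at the reference level) for all `w`, two compatible `C`-fixed vertex systems `x`, `x'` whose level
  geodesics are CONFINED over `e₀` (every branch on `[x_k, x'_k]` lies over `e₀`) satisfy
  `dist (x_j, x'_j) ≤ 4` at every level (w6-d062's proof with `F` shrunk; nothing else changes);
* `localLevelEstranged_overEdge_temperedPiChart` — (LE_C,w)|_{e₀} HOLDS at the canonical tower of every
  countable `𝒢` satisfying the hypotheses of Thm. 3.7, for every subgroup `C ≠ 1`, every base vertex `w`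
  (ANY valence) and every base edge `e₀` (from w6-d062's two per-pair depth lemmas over the ≤ 2 branches
  of `e₀`);
* `dist_le_four_of_confined_temperedPiChart` — hence at the canonical tower: a compatible `C`-fixed pair
  confined over one base edge stays at distance `≤ 4` (no finiteness of `𝔾`, no local finiteness);
* `mem_verticial_of_centralizer_of_confined` — with abc-iut-f-172 gen 4's
  `mem_verticial_of_centralizer_of_bounded_displacement`: an element `g` centralising a compact `C ≠ 1`
  with verticial host `H ⊇ C` (fixed system `y`) whose pair `(y, g·y)` is confined over one base edge lies
  in `H` — case (I) of the memo's trichotomy for the infinite-valence residual of F-2772/F-2773 is EMPTY: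
  an escaping centraliser must cross at least two base edges at some level (and then, by the seat's
  `TreeSystemGeodesicBaseEdges.lean`, at all higher levels).

Honest framing: the ∀-closures F-2773 / F-1732 are NOT claimed; nothing here bears on [IUTchIII]
Cor. 3.12; typed ≠ proved elsewhere.
-/

namespace Literature.AnabelianGeometry.SemiGraphs

namespace ProfiniteSemiGraph

namespace VerticialLevelData

open CategoryTheory Topology

universe v u

variable {𝒢 : ProfiniteSemiGraph.{u}} {c : TemperedPiChart 𝒢} (D : VerticialLevelData.{v} 𝒢 c)

/-- The first step of a walk of the subdivision between the points of two distinct vertices is a branch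
abutting to the origin. [cite: MochizukiSemiAnbd2006, §1 pp.11-12] -/
private theorem exists_branch_mem_support' {T : SemiGraph.{u}} {y y' : T.Vertex} (hne : y ≠ y')
    (p : T.subdivision.Walk (Sum.inl y) (Sum.inl y')) :
    ∃ β : T.Branch, T.abuts β = some y ∧ (Sum.inr (Sum.inr β) : T.Node) ∈ p.support := by
  cases p with
  | nil => exact (hne rfl).elim
  | cons h q =>
    obtain ⟨β, hβ, hq⟩ := (T.subdivision_adj_inl_iff y _).1 h
    subst hq
    exact ⟨β, hβ, by simp⟩

/-- Base vertices along the transition maps: `proj_k (v) = proj_j (trans v)`.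
[cite: MochizukiSemiAnbd2006, Thm 3.7(iii) p.41] -/
private theorem proj_vertexMap_eq_proj_trans' ⦃j k : D.J⦄ (h : j ≤ k) (v : (D.tree k).Vertex) :
    (D.proj k).vertexMap v = (D.proj j).vertexMap ((D.trans h).vertexMap v) := by
  have e := congrArg (fun φ => SemiGraph.Hom.vertexMap φ v) (D.trans_over h)
  simpa only [SemiGraph.comp_vertexMap, Function.comp_apply] using e.symm

/-- Base edges along the transition maps: `proj_k (η) = proj_j (trans η)`.
[cite: MochizukiSemiAnbd2006, Thm 3.7(iii) p.41] -/
private theorem proj_edgeMap_eq_proj_trans' ⦃j k : D.J⦄ (h : j ≤ k) (η : (D.tree k).Edge) :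
    (D.proj k).edgeMap η = (D.proj j).edgeMap ((D.trans h).edgeMap η) := by
  have e := congrArg (fun φ => SemiGraph.Hom.edgeMap φ η) (D.trans_over h)
  simpa only [SemiGraph.comp_edgeMap, Function.comp_apply] using e.symm

/-- **`hbdd` with bound `4` for pairs CONFINED over one base edge, from level-estrangement restricted to
that edge** ([SemiAnbd] Thm 3.7 (iii), second sentence, at an arbitrary countable `𝔾`, any valence).
Hypotheses: (LE_C,w)|_{e₀} — for every base vertex `w` and level `j`, from some level on, at tree vertices
over `w`, two `C`-fixed edges of distinct branches BOTH LYING OVER THE BASE EDGE `e₀` have the same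
level-`j` image; and the compatible `C`-fixed vertex systems `x`, `x'` are confined over `e₀`: every branch
on the geodesic `[x_k, x'_k]` of every level lies over `e₀`.  Conclusion: `dist (x_j, x'_j) ≤ 4` at every
level.  Proof: abc-iut-w6-d062's `dist_le_four_of_localLevelEstranged` verbatim with the folding set
`F` shrunk to the `C`-fixed nodes whose branches lie over `e₀` (the folding hypothesis of
`SemiGraph.vertexMap_eq_or_eq_of_folding` then only meets branch pairs over `e₀`).
[cite: MochizukiSemiAnbd2006, Thm 3.7(iii) p.41] -/
theorem dist_le_four_of_confined (C : Subgroup c.G) (e₀ : 𝒢.graph.Edge)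
    (hLE : ∀ (w : 𝒢.graph.Vertex) (j : D.J), ∃ (k : D.J) (hjk : j ≤ k), ∀ (k' : D.J) (hkk' : k ≤ k')
      (v : (D.tree k').Vertex), (D.proj k').vertexMap v = w →
      ∀ (b b' : (D.tree k').Branch), (D.tree k').abuts b = some v → (D.tree k').abuts b' = some v →
      (D.proj k').edgeMap ((D.tree k').edgeOf b) = e₀ → (D.proj k').edgeMap ((D.tree k').edgeOf b') = e₀ →
      (D.tree k').edgeOf b ≠ (D.tree k').edgeOf b' →
      (∀ g ∈ C, (D.act k' g).hom.edgeMap ((D.tree k').edgeOf b) = (D.tree k').edgeOf b) →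
      (∀ g ∈ C, (D.act k' g).hom.edgeMap ((D.tree k').edgeOf b') = (D.tree k').edgeOf b') →
      (D.trans (hjk.trans hkk')).edgeMap ((D.tree k').edgeOf b) =
        (D.trans (hjk.trans hkk')).edgeMap ((D.tree k').edgeOf b'))
    (x x' : ∀ j, (D.tree j).Vertex)
    (hx : ∀ ⦃i j : D.J⦄ (h : i ≤ j), (D.trans h).vertexMap (x j) = x i)
    (hx' : ∀ ⦃i j : D.J⦄ (h : i ≤ j), (D.trans h).vertexMap (x' j) = x' i)
    (hfx : ∀ g ∈ C, ∀ j, (D.act j g).hom.vertexMap (x j) = x j)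
    (hfx' : ∀ g ∈ C, ∀ j, (D.act j g).hom.vertexMap (x' j) = x' j)
    (hconf : ∀ (k : D.J) (p : (D.tree k).subdivision.Walk (Sum.inl (x k)) (Sum.inl (x' k))), p.IsPath →
      ∀ β : (D.tree k).Branch, (Sum.inr (Sum.inr β) : (D.tree k).Node) ∈ p.support →
        (D.proj k).edgeMap ((D.tree k).edgeOf β) = e₀)
    (j : D.J) :
    (D.tree j).subdivision.dist (Sum.inl (x j)) (Sum.inl (x' j)) ≤ 4 := by
  classical
  -- the `C`-fixed points of a level whose branches lie over `e₀`, and the confined fixed geodesic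
  let F : ∀ k : D.J, Set (D.tree k).Node := fun k =>
    {z | (∀ g ∈ C, SemiGraph.nodeMap (D.act k g) z = z) ∧
      ∀ β : (D.tree k).Branch, z = Sum.inr (Sum.inr β) → (D.proj k).edgeMap ((D.tree k).edgeOf β) = e₀}
  have hpath : ∀ k : D.J, ∃ p : (D.tree k).subdivision.Walk (Sum.inl (x k)) (Sum.inl (x' k)),
      ∀ z ∈ p.support, z ∈ F k := by
    intro k
    have hT := (D.isTree k).isTree
    let p : (D.tree k).subdivision.Path (Sum.inl (x k)) (Sum.inl (x' k)) :=
      (hT.connected (Sum.inl (x k)) (Sum.inl (x' k))).some.toPath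
    refine ⟨p.1, fun z hz => ⟨fun g hg => ?_, fun β hβ => ?_⟩⟩
    · have hxn : SemiGraph.nodeMap (D.act k g) (Sum.inl (x k)) = Sum.inl (x k) := by simp [hfx g hg k]
      have hx'n : SemiGraph.nodeMap (D.act k g) (Sum.inl (x' k)) = Sum.inl (x' k) := by simp [hfx' g hg k]
      exact SemiGraph.nodeMap_eq_self_of_isPath hT.isAcyclic _ hxn hx'n p.1 p.2 z hz
    · subst hβ
      exact hconf k p.1 p.2 β hz
  -- fixed branch-points have fixed edges
  have hFedge : ∀ (k : D.J) (β : (D.tree k).Branch), (Sum.inr (Sum.inr β) : (D.tree k).Node) ∈ F k →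
      ∀ g ∈ C, (D.act k g).hom.edgeMap ((D.tree k).edgeOf β) = (D.tree k).edgeOf β := by
    intro k β hβ g hg
    have h := hβ.1 g hg
    simp only [SemiGraph.nodeMap_inr_inr, Sum.inr.injEq] at h
    rw [← (D.act k g).hom.edgeOf_branchMap β, h]
  -- branch-points of `F` lie over `e₀`
  have hFover : ∀ (k : D.J) (β : (D.tree k).Branch), (Sum.inr (Sum.inr β) : (D.tree k).Node) ∈ F k →
      (D.proj k).edgeMap ((D.tree k).edgeOf β) = e₀ := fun k β hβ => hβ.2 β rfl
  -- the base vertex under `x`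
  set u : 𝒢.graph.Vertex := (D.proj j).vertexMap (x j) with hu
  have hxu : ∀ (k : D.J) (h : j ≤ k), (D.proj k).vertexMap (x k) = u := fun k h => by
    rw [D.proj_vertexMap_eq_proj_trans' h, hx h]
  -- level `k₁` from (LE)|_{e₀} at `u`
  obtain ⟨k₁, hjk₁, h₁⟩ := hLE u j
  by_cases heq₁ : x k₁ = x' k₁
  · have hxj : x j = x' j := by rw [← hx hjk₁, ← hx' hjk₁, heq₁]
    rw [hxj, SimpleGraph.dist_self]; exact Nat.zero_le _
  -- the first fixed branch `β₁` at `x k₁`, its image edge `ε*` at level `j`, the far end `a'` over `w*`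
  obtain ⟨p₁, hp₁⟩ := hpath k₁
  obtain ⟨β₁, hβ₁, hβ₁F⟩ := exists_branch_mem_support' heq₁ p₁
  set ε : (D.tree j).Edge := (D.trans hjk₁).edgeMap ((D.tree k₁).edgeOf β₁) with hε
  have hc₀ε : (D.tree j).edgeOf ((D.trans hjk₁).branchMap β₁) = ε := (D.trans hjk₁).edgeOf_branchMap β₁
  have hc₀a : (D.tree j).abuts ((D.trans hjk₁).branchMap β₁) = some (x j) := by
    rw [(D.trans hjk₁).abuts_branchMap β₁ _ hβ₁, hx hjk₁]
  obtain ⟨a', hends, hdist⟩ := SemiGraph.exists_ends_dist_le_four ε _ hc₀ε hc₀a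
  set w : 𝒢.graph.Vertex := (D.proj j).vertexMap a' with hw
  -- level `k'` beyond `k₁` and beyond the (LE)|_{e₀}-level at `w*`
  obtain ⟨k₂, hjk₂, h₂⟩ := hLE w j
  obtain ⟨k', hk₁k', hk₂k'⟩ := exists_ge_ge k₁ k₂
  have hjk' : j ≤ k' := hjk₁.trans hk₁k'
  have hne' : x k' ≠ x' k' := fun h => heq₁ (by rw [← hx hk₁k', ← hx' hk₁k', h])
  obtain ⟨p', hp'⟩ := hpath k'
  obtain ⟨β', hβ', hβ'F⟩ := exists_branch_mem_support' hne' p'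
  -- the first fixed branch at level `k'` still maps to `ε*` (by (LE)|_{e₀} at `u`, level `k₁`)
  have hβ'ε : (D.trans hjk').edgeMap ((D.tree k').edgeOf β') = ε := by
    -- its image at level `k₁` is a `C`-fixed edge of a branch at `x k₁`, over `e₀`
    have himg : (D.trans hjk').edgeMap ((D.tree k').edgeOf β') =
        (D.trans hjk₁).edgeMap ((D.tree k₁).edgeOf ((D.trans hk₁k').branchMap β')) := by
      rw [(D.trans hk₁k').edgeOf_branchMap,
        show D.trans hjk' = D.trans hk₁k' ≫ D.trans hjk₁ from (D.trans_comp hjk₁ hk₁k').symm,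
        SemiGraph.comp_edgeMap, Function.comp_apply]
    rw [himg, hε]
    by_cases hee : (D.tree k₁).edgeOf ((D.trans hk₁k').branchMap β') = (D.tree k₁).edgeOf β₁
    · rw [hee]
    · have habut : (D.tree k₁).abuts ((D.trans hk₁k').branchMap β') = some (x k₁) := by
        rw [(D.trans hk₁k').abuts_branchMap β' _ hβ', hx hk₁k']
      have hfix' : ∀ g ∈ C, (D.act k₁ g).hom.edgeMap ((D.tree k₁).edgeOf ((D.trans hk₁k').branchMap β')) =
          (D.tree k₁).edgeOf ((D.trans hk₁k').branchMap β') := by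
        intro g hg
        rw [(D.trans hk₁k').edgeOf_branchMap, ← D.trans_act_edgeMap hk₁k' g, hFedge k' β' (hp' _ hβ'F) g hg]
      have hover' : (D.proj k₁).edgeMap ((D.tree k₁).edgeOf ((D.trans hk₁k').branchMap β')) = e₀ := by
        rw [(D.trans hk₁k').edgeOf_branchMap, ← D.proj_edgeMap_eq_proj_trans' hk₁k', hFover k' β' (hp' _ hβ'F)]
      have key := h₁ k₁ le_rfl (x k₁) (hxu k₁ hjk₁) _ _ habut hβ₁ hover' (hFover k₁ β₁ (hp₁ _ hβ₁F)) hee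
        hfix' (hFedge k₁ β₁ (hp₁ _ hβ₁F))
      simpa using key
  -- FOLD at level `k'` along the transition to level `j`
  have hfold := SemiGraph.vertexMap_eq_or_eq_of_folding (D.trans hjk') (F k') hends ?_ p' hp'
    (Or.inl (hx hjk')) β' (hp' _ hβ'F) hβ' hβ'ε
  · -- conclusion: `x' j ∈ {x j, a'}`
    rw [hx' hjk'] at hfold
    rcases hfold with h | h
    · rw [h, SimpleGraph.dist_self]; exact Nat.zero_le _
    · rw [h]; exact hdist
  · -- the folding hypothesis at tree vertices mapping to `x j` (over `u`) or to `a'` (over `w*`),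
    -- for branch pairs OVER `e₀` only
    intro v hvF hv β β'' hβF hβ''F hβv hβ''v
    by_cases hee : (D.tree k').edgeOf β = (D.tree k').edgeOf β''
    · rw [hee]
    rcases hv with hv | hv
    · -- over `u`: (LE)|_{e₀} at `u`, level `k' ≥ k₁`
      have hvu : (D.proj k').vertexMap v = u := by rw [D.proj_vertexMap_eq_proj_trans' hjk', hv]
      have key := h₁ k' hk₁k' v hvu β β'' hβv hβ''v (hFover k' β hβF) (hFover k' β'' hβ''F) hee
        (hFedge k' β hβF) (hFedge k' β'' hβ''F)
      simpa using key
    · -- over `w*`: (LE)|_{e₀} at `w*`, level `k' ≥ k₂`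
      have hvw : (D.proj k').vertexMap v = w := by rw [D.proj_vertexMap_eq_proj_trans' hjk', hv]
      have key := h₂ k' hk₂k' v hvw β β'' hβv hβ''v (hFover k' β hβF) (hFover k' β'' hβ''F) hee
        (hFedge k' β hβF) (hFedge k' β'' hβ''F)
      simpa using key

end VerticialLevelData

/-! ### (LE_C,w)|_{e₀} at the canonical tower — ANY valence -/

section Canonical

open CategoryTheory Topology

universe u

variable (𝒢 : ProfiniteSemiGraph.{u}) (h37 : 𝒢.Thm37Hypotheses)

/-- **Level-estrangement restricted to one base edge holds at the canonical tower, at a vertex of ANY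
valence** (for every subgroup `C ≠ 1`): for every base vertex `w`, base edge `e₀` and level `j` there is a
level from which on, at tree vertices over `w`, two `C`-fixed edges of distinct branches at a common vertex
BOTH LYING OVER `e₀` have the same image in `𝔾̃_j`.  The branches of `e₀` at `w` being at most two, this
is abc-iut-w6-d062's estrangement in depth for the (at most one) pair of DISTINCT base branches of `e₀`
at `w` (`eventually_not_fixed_pair_of_ne_base_pair`) and the same-base-branch fold
(`eventually_fold_same_base_pair`) for each of them — no finiteness of the star of `w`.
[cite: MochizukiSemiAnbd2006, Thm 3.7(iii) p.41] -/
theorem localLevelEstranged_overEdge_temperedPiChart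
    (C : Subgroup (𝒢.temperedPiChart h37.toProp36Hypotheses).G) (hC : C ≠ ⊥)
    (w : 𝒢.graph.Vertex) (e₀ : 𝒢.graph.Edge) (j : ℕ) :
    ∃ (k : ℕ) (hjk : j ≤ k), ∀ (k' : ℕ) (hkk' : k ≤ k')
      (v : ((𝒢.galoisLevelData h37.toProp36Hypotheses).tree k').Vertex),
      ((𝒢.galoisLevelData h37.toProp36Hypotheses).treeProj k').vertexMap v = w →
      ∀ (b b' : ((𝒢.galoisLevelData h37.toProp36Hypotheses).tree k').Branch),
      ((𝒢.galoisLevelData h37.toProp36Hypotheses).tree k').abuts b = some v →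
      ((𝒢.galoisLevelData h37.toProp36Hypotheses).tree k').abuts b' = some v →
      ((𝒢.galoisLevelData h37.toProp36Hypotheses).treeProj k').edgeMap
          (((𝒢.galoisLevelData h37.toProp36Hypotheses).tree k').edgeOf b) = e₀ →
      ((𝒢.galoisLevelData h37.toProp36Hypotheses).treeProj k').edgeMap
          (((𝒢.galoisLevelData h37.toProp36Hypotheses).tree k').edgeOf b') = e₀ →
      ((𝒢.galoisLevelData h37.toProp36Hypotheses).tree k').edgeOf b ≠
        ((𝒢.galoisLevelData h37.toProp36Hypotheses).tree k').edgeOf b' →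
      (∀ g ∈ C, ((𝒢.galoisLevelData h37.toProp36Hypotheses).treeAct h37.toProp36Hypotheses.isCountable k' g).hom.edgeMap
          (((𝒢.galoisLevelData h37.toProp36Hypotheses).tree k').edgeOf b) =
        ((𝒢.galoisLevelData h37.toProp36Hypotheses).tree k').edgeOf b) →
      (∀ g ∈ C, ((𝒢.galoisLevelData h37.toProp36Hypotheses).treeAct h37.toProp36Hypotheses.isCountable k' g).hom.edgeMap
          (((𝒢.galoisLevelData h37.toProp36Hypotheses).tree k').edgeOf b') =
        ((𝒢.galoisLevelData h37.toProp36Hypotheses).tree k').edgeOf b') →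
      ((𝒢.galoisLevelData h37.toProp36Hypotheses).treeTrans (hjk.trans hkk')).edgeMap
          (((𝒢.galoisLevelData h37.toProp36Hypotheses).tree k').edgeOf b) =
        ((𝒢.galoisLevelData h37.toProp36Hypotheses).treeTrans (hjk.trans hkk')).edgeMap
          (((𝒢.galoisLevelData h37.toProp36Hypotheses).tree k').edgeOf b') := by
  classical
  set D := 𝒢.galoisLevelData h37.toProp36Hypotheses with hD
  -- a non-trivial element of `C`, non-trivial at some level `j₀`
  obtain ⟨c, hcC, hc1⟩ : ∃ c ∈ C, c ≠ 1 := by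
    by_contra h
    push Not at h
    exact hC ((Subgroup.eq_bot_iff_forall C).2 h)
  obtain ⟨j₀, hc⟩ := 𝒢.exists_proj_ne_one h37.toProp36Hypotheses c hc1
  -- the (at most two) base branches of `e₀` at `w`
  let B := {b : 𝒢.graph.Branch // 𝒢.graph.abuts b = some w ∧ 𝒢.graph.edgeOf b = e₀}
  haveI : Finite B := by
    obtain ⟨b₁, b₂, -, -, -, hall⟩ := 𝒢.graph.two_branches e₀
    haveI : Finite ({b₁, b₂} : Set 𝒢.graph.Branch) := ((Set.finite_singleton b₂).insert b₁).to_subtype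
    refine Finite.of_injective (fun b : B => (⟨b.1, ?_⟩ : ({b₁, b₂} : Set 𝒢.graph.Branch))) ?_
    · rcases hall b.1 b.2.2 with h | h
      · exact Or.inl h
      · exact Or.inr h
    · rintro ⟨b, hb⟩ ⟨b', hb'⟩ h
      simp only [Subtype.mk.injEq] at h
      exact Subtype.ext h
  -- same base branch: one fold level per branch of `e₀` at `w`
  have hk := fun b : B => 𝒢.eventually_fold_same_base_pair h37 c j₀ hc w b.2.1 j
  choose kf hkf using hk
  obtain ⟨K, hK⟩ := (Set.finite_range kf).bddAbove
  -- distinct base branches: one exclusion level per ordered pair of distinct branches of `e₀` at `w`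
  let P := {p : B × B // p.1.1 ≠ p.2.1}
  haveI : Finite P := Subtype.finite
  have hk' := fun p : P =>
    𝒢.eventually_not_fixed_pair_of_ne_base_pair h37 c j₀ hc w p.1.1.2.1 p.1.2.2.1 p.2
  choose kg hkg using hk'
  obtain ⟨K', hK'⟩ := (Set.finite_range kg).bddAbove
  refine ⟨max (max K K') j, le_max_right _ _, fun k' hkk' v hv b b' hb hb' hbe hb'e hne hfix hfix' => ?_⟩
  -- a point sequence over `w` through `v`
  obtain ⟨Pt, hPv⟩ : ∃ Pt : D.PointSeq h37.toProp36Hypotheses.isCountable w, Pt.vertex k' = v := by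
    subst hv
    exact exists_pointSeq_vertex_eq_galoisLevelData h37.toProp36Hypotheses k' v
  -- the base branches of `b`, `b'`: branches of `e₀` at `w`
  have hb₀ : 𝒢.graph.abuts ((D.treeProj k').branchMap b) = some w := by
    rw [(D.treeProj k').abuts_branchMap b v hb, hv]
  have hb₀' : 𝒢.graph.abuts ((D.treeProj k').branchMap b') = some w := by
    rw [(D.treeProj k').abuts_branchMap b' v hb', hv]
  have hb₀e : 𝒢.graph.edgeOf ((D.treeProj k').branchMap b) = e₀ := by
    rw [(D.treeProj k').edgeOf_branchMap b, hbe]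
  have hb₀'e : 𝒢.graph.edgeOf ((D.treeProj k').branchMap b') = e₀ := by
    rw [(D.treeProj k').edgeOf_branchMap b', hb'e]
  let β₀ : B := ⟨_, hb₀, hb₀e⟩
  let β₀' : B := ⟨_, hb₀', hb₀'e⟩
  rw [← hPv] at hb hb'
  by_cases hbase : (D.treeProj k').branchMap b = (D.treeProj k').branchMap b'
  · -- same base branch: the fold
    have hkle : kf β₀ ≤ k' := ((hK ⟨β₀, rfl⟩).trans ((le_max_left _ _).trans (le_max_left _ _))).trans hkk'
    have hfold := (hkf β₀).2.2 k' hkle Pt b b' rfl hbase.symm hb hb' (hfix c hcC) (hfix' c hcC)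
      (le_trans (le_max_right _ _) hkk')
    rw [← (D.treeTrans _).edgeOf_branchMap b, ← (D.treeTrans _).edgeOf_branchMap b', hfold]
  · -- distinct base branches of `e₀` at `w`: excluded at these levels
    let p : P := ⟨(β₀, β₀'), hbase⟩
    have hkle : kg p ≤ k' := ((hK' ⟨p, rfl⟩).trans ((le_max_right _ _).trans (le_max_left _ _))).trans hkk'
    exact ((hkg p).2 k' hkle Pt b b' rfl rfl hb hb' (hfix c hcC) (hfix' c hcC)).elim

/-- **`hbdd` (bound `4`) for CONFINED pairs at the canonical tower, ANY valence.**  For every countable `𝒢`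
satisfying the hypotheses of Thm. 3.7, every subgroup `C ≠ 1` of `π₁^temp(𝒢)` and every base edge `e₀`:
two compatible `C`-fixed vertex systems of the canonical level data whose level geodesics are confined
over `e₀` (all their branches lie over `e₀`) are, at every level, equal or the two ends of one edge.
[cite: MochizukiSemiAnbd2006, Thm 3.7(iii) p.41] -/
theorem dist_le_four_of_confined_temperedPiChart
    (C : Subgroup (𝒢.temperedPiChart h37.toProp36Hypotheses).G) (hC : C ≠ ⊥) (e₀ : 𝒢.graph.Edge)
    (x x' : ∀ j, ((verticialLevelData_temperedPiChart (h36 := h37.toProp36Hypotheses)).tree j).Vertex)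
    (hx : ∀ ⦃i j : ℕ⦄ (hij : i ≤ j),
      ((verticialLevelData_temperedPiChart (h36 := h37.toProp36Hypotheses)).trans hij).vertexMap (x j) = x i)
    (hx' : ∀ ⦃i j : ℕ⦄ (hij : i ≤ j),
      ((verticialLevelData_temperedPiChart (h36 := h37.toProp36Hypotheses)).trans hij).vertexMap (x' j) = x' i)
    (hfx : ∀ g ∈ C, ∀ j,
      ((verticialLevelData_temperedPiChart (h36 := h37.toProp36Hypotheses)).act j g).hom.vertexMap (x j) = x j)
    (hfx' : ∀ g ∈ C, ∀ j,
      ((verticialLevelData_temperedPiChart (h36 := h37.toProp36Hypotheses)).act j g).hom.vertexMap (x' j) = x' j)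
    (hconf : ∀ (k : ℕ)
      (p : ((verticialLevelData_temperedPiChart (h36 := h37.toProp36Hypotheses)).tree k).subdivision.Walk
        (Sum.inl (x k)) (Sum.inl (x' k))), p.IsPath →
      ∀ β : ((verticialLevelData_temperedPiChart (h36 := h37.toProp36Hypotheses)).tree k).Branch,
        (Sum.inr (Sum.inr β) : ((verticialLevelData_temperedPiChart (h36 := h37.toProp36Hypotheses)).tree k).Node)
          ∈ p.support →
        ((verticialLevelData_temperedPiChart (h36 := h37.toProp36Hypotheses)).proj k).edgeMap
          (((verticialLevelData_temperedPiChart (h36 := h37.toProp36Hypotheses)).tree k).edgeOf β) = e₀)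
    (j : ℕ) :
    ((verticialLevelData_temperedPiChart (h36 := h37.toProp36Hypotheses)).tree j).subdivision.dist
      (Sum.inl (x j)) (Sum.inl (x' j)) ≤ 4 :=
  (verticialLevelData_temperedPiChart (h36 := h37.toProp36Hypotheses)).dist_le_four_of_confined C e₀
    (fun w j => 𝒢.localLevelEstranged_overEdge_temperedPiChart h37 C hC w e₀ j) x x' hx hx' hfx hfx' hconf j

/-- **No escaping centraliser is confined over one base edge** (case (I) of the trichotomy for the
infinite-valence residual of F-2772/F-2773, ANY valence): at the canonical tower of a countable `𝒢`
satisfying the hypotheses of Thm. 3.7, let `C ≠ 1` be compact, `H ⊇ C` verticial with a compatible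
`H`-fixed vertex system `y`, and `g` centralise `C`.  If the pair `(y, g·y)` is confined over some base edge
`e₀` (every branch on every level geodesic `[y_k, g·y_k]` lies over `e₀`), then `g ∈ H` — by
`dist_le_four_of_confined_temperedPiChart` and abc-iut-f-172 gen 4's
`mem_verticial_of_centralizer_of_bounded_displacement`. [cite: MochizukiSemiAnbd2006, Cor 3.9 p.43] -/
theorem mem_verticial_of_centralizer_of_confined
    (C : Subgroup (𝒢.temperedPiChart h37.toProp36Hypotheses).G)
    (hCc : IsCompact (C : Set (𝒢.temperedPiChart h37.toProp36Hypotheses).G)) (hC : C ≠ ⊥)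
    {v : 𝒢.graph.Vertex} {H : Subgroup (𝒢.temperedPiChart h37.toProp36Hypotheses).G}
    (hH : H ∈ verticialSubgroups (𝒢.temperedPiChart h37.toProp36Hypotheses) v) (hCH : C ≤ H)
    (y : ∀ j, ((verticialLevelData_temperedPiChart (h36 := h37.toProp36Hypotheses)).tree j).Vertex)
    (hyc : ∀ ⦃i j : ℕ⦄ (hij : i ≤ j),
      ((verticialLevelData_temperedPiChart (h36 := h37.toProp36Hypotheses)).trans hij).vertexMap (y j) = y i)
    (hyH : ∀ h ∈ H, ∀ j,
      ((verticialLevelData_temperedPiChart (h36 := h37.toProp36Hypotheses)).act j h).hom.vertexMap (y j) = y j)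
    (g : (𝒢.temperedPiChart h37.toProp36Hypotheses).G)
    (hg : g ∈ Subgroup.centralizer (C : Set (𝒢.temperedPiChart h37.toProp36Hypotheses).G))
    (e₀ : 𝒢.graph.Edge)
    (hconf : ∀ (k : ℕ)
      (p : ((verticialLevelData_temperedPiChart (h36 := h37.toProp36Hypotheses)).tree k).subdivision.Walk
        (Sum.inl (y k))
        (Sum.inl (((verticialLevelData_temperedPiChart (h36 := h37.toProp36Hypotheses)).act k g).hom.vertexMap
          (y k)))), p.IsPath →
      ∀ β : ((verticialLevelData_temperedPiChart (h36 := h37.toProp36Hypotheses)).tree k).Branch,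
        (Sum.inr (Sum.inr β) : ((verticialLevelData_temperedPiChart (h36 := h37.toProp36Hypotheses)).tree k).Node)
          ∈ p.support →
        ((verticialLevelData_temperedPiChart (h36 := h37.toProp36Hypotheses)).proj k).edgeMap
          (((verticialLevelData_temperedPiChart (h36 := h37.toProp36Hypotheses)).tree k).edgeOf β) = e₀) :
    g ∈ H := by
  have hcomm : ∀ k ∈ C, k * g = g * k := fun k hk => Subgroup.mem_centralizer_iff.mp hg k hk
  have hyC : ∀ k ∈ C, ∀ j,
      ((verticialLevelData_temperedPiChart (h36 := h37.toProp36Hypotheses)).act j k).hom.vertexMap (y j) =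
        y j := fun k hk j => hyH k (hCH hk) j
  have hy₁c := (verticialLevelData_temperedPiChart (h36 := h37.toProp36Hypotheses)).translate_compat' g hyc
  have hy₁C := (verticialLevelData_temperedPiChart (h36 := h37.toProp36Hypotheses)).translate_fixed' hcomm hyC
  exact 𝒢.mem_verticial_of_centralizer_of_bounded_displacement h37 C hCc hC hH hCH y hyc hyH g hg
    ⟨4, fun j => 𝒢.dist_le_four_of_confined_temperedPiChart h37 C hC e₀ y
      (fun j => ((verticialLevelData_temperedPiChart (h36 := h37.toProp36Hypotheses)).act j g).hom.vertexMap
        (y j)) hyc hy₁c hyC hy₁C hconf j⟩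

end Canonical

end ProfiniteSemiGraph

end Literature.AnabelianGeometry.SemiGraphs
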